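import Mathlib.Analysis.Real.Cardinality
import Literature.Probability.Percolation.OneArmSubsequentialLimits
import HarnessLib

/-!
# LSW's (3.1) with Theorem 1.2 from subsequential limits and radial convergence (proofs only)

Topic `Literature/Probability/Percolation`; family `crit-perc`. Def-free, fact-free companion of
`OneArmLSW.lean`, the home of the named fact
`Literature.Probability.Percolation.LawlerSchrammWerner2002_annulusCrossing` — Lawler–Schramm–
Werner, *One-arm exponent for critical 2D percolation*, Electron. J. Probab. **7** (2002), paper
no. 2, **Theorem 1.2** (p. 2) together with **(3.1)** (p. 8): there is `u` with
`log u(r) / log r → 5/48` (`r ↓ 0`; "By Theorem 1.2", p. 9, first line) and, for every fixed `r`,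
`u(r/2)/2 ≤ P[C(rR, R)] ≤ 2 u(2r)` for all `R ≥ s₀(r)` ("By the definition of the scaling limit",
p. 8), `C(R₁, R₂)` the open crossing of the annulus of radii `R₁ < R₂` about `0` by critical site
percolation on `𝕋` (`triOpenCrossing`).

State of its discharge before this file. `OneArmScalingLimit.lean` proves the fact from the
existence of the scaling limit (the laws `lswLaw R` of LSW's sets `Q_{1/R}` converge weakly on the
Hausdorff space as `R → ∞`; LSW §2 p. 3, Smirnov 2001, Camia–Newman 2006; then the named fact
`LawlerSchrammWerner2002_scalingLimit`, since 2026-08-15 the explicit hypothesis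
`∃ ν, Tendsto lswLaw atTop (𝓝 ν)`) and the named fact `LawlerSchrammWerner2002_scalingLimitExponent`
(Thm. 1.2 for the limit), the latter being
reduced to `LawlerSchrammWerner2002_hittingPDE` (`OneArmHittingPDEProofs.lean`) and further to the
*subsequential hitting-PDE hypotheses* of `OneArmSubsequentialLimits.lean` (one datum
`(h, h_θ, h_θθ, h_t)` with the properties of Lemma 2.2, (2.3), Lemma 2.3, identified through (2.2)
at `θ = 2π` with EVERY subsequential weak limit of `lswLaw`; `OneArmScalingLimitProofs.lean`).
From those hypotheses alone `OneArmSubsequentialLimits.lean` proves the one-arm exponent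
(Thm. 1.1) through ONE-SIDED (3.1)-type bounds `C⁻¹ r^{5/48} / 2 ≤ P[C(rR, R)] ≤ 2 C r^{5/48}`
(`crossingBounds_of_subseqLimits`), bypassing the present fact: its two-sided sandwich with a
single function `u` compares the crossing probabilities at DIFFERENT scales (it forces
`P[C(rR, R)] ≤ 4 P[C(4rR', R')]` for all large `R, R'`, `r < 1/8`), which bounds at
subsequential limits alone do not give.

This file isolates how little convergence suffices. Not the weak limit on the Hausdorff
space: only the existence, for all radii `r ∈ (0, 1)` off a countable set, of the limit of the
one-arm annulus probabilities `lim_{R → ∞} P[C(rR, R)]` ("radial convergence"; in LSW's words the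
definition of the scaling limit as far as (3.1) uses it, and a consequence of
the existence of the weak limit by the portmanteau theorem at continuity radii —
`tendsto_real_triOpenCrossing_of_scalingLimit` below).

* `LawlerSchrammWerner2002_annulusCrossing_of_crossingBounds_of_tendsto` — the elementary core:
  uniform power bounds `C⁻¹ r^{5/48}/2 ≤ P[C(rR, R)] ≤ 2 C r^{5/48}` for large `R` (the output of
  `crossingBounds_of_subseqLimits`) and convergence of `P[C(r'R, R)]` at one radius `r'` in every
  window `[r/2, r]` give the fact with `u(r) := limsup_{R → ∞} P[C(rR, R)]`: `u` is non-decreasing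
  (`C(r'R, R) ⊆ C(rR, R)` for `r' ≤ r`), inherits the power bounds (hence "log u(r)/log r → 5/48",
  `tendsto_log_div_log_of_rpow_bounds`), the upper half of (3.1) is
  `limsup_R P[C(rR, R)] = u(r) ≤ u(2r) < 2 u(2r)`, and the lower half is
  `P[C(rR, R)] ≥ P[C(r'R, R)] → u(r') ≥ u(r/2) > u(r/2)/2`.
* `LawlerSchrammWerner2002_annulusCrossing_of_subseqHittingPDE` — MAIN: the subsequential
  hitting-PDE hypotheses (`H`, `hid`, verbatim those of `oneArm_exponent_of_subseqHittingPDE`)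
  and radial convergence off a countable set of radii imply
  `LawlerSchrammWerner2002_annulusCrossing` (uniform constant of Thm. 1.2 from
  `IsHittingPDEData.measure_bounds` with Koebe's constant `koebeCovering_const`; windows meet the
  complement of a countable set since `[r/2, r]` is uncountable, `Cardinal.Real.Icc_countable_iff`);
  `LawlerSchrammWerner2002_annulusCrossing_of_subseqHittingPDE'` is the version with convergence
  at every radius.
* `tendsto_real_triOpenCrossing_of_scalingLimit` — the weak limit of `lswLaw` gives radial
  convergence off the (countable) set of atoms of `dist(0, K)` under the limit law
  (Billingsley 1999, Thm. 2.1, at the continuity sets `{dist(0, K) < r}`;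
  `C(rR, R) = {Q_{1/R} ∈ meetsBall r}`, `real_triOpenCrossing_eq`).
* `LawlerSchrammWerner2002_annulusCrossing_of_scalingLimit_of_subseqHittingPDE` — hence the fact
  from the weak limit and the subsequential hitting-PDE hypotheses; with
  `LawlerSchrammWerner2002_subseqHittingPDE_of_scalingLimit` this recovers the printed route
  `scalingLimit ∧ hittingPDE ⇒ annulusCrossing` of `OneArmHittingPDEProofs.lean` /
  `OneArmScalingLimit.lean`, so the hypotheses here are weaker than what is printed.

What is NOT here: no discharge. `LawlerSchrammWerner2002_annulusCrossing_holds` still needs the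
probabilistic input of LSW §2 (Smirnov's theorem as LSW use it and the radial-`SLE₆` law of the
conformal radius, i.e. the content of `LawlerSchrammWerner2002_hittingPDE`) and radial
convergence (a fragment of the existence of the scaling limit), neither of which is in
Mathlib or in this library. No new definitions, no new named facts.

## References

* G. F. Lawler, O. Schramm, W. Werner, *One-arm exponent for critical 2D percolation*, Electron.
  J. Probab. 7 (2002), no. 2 — Thm. 1.2 (p. 2), §3 (3.1) (p. 8), p. 9 first line
  [LawlerSchrammWernerEJP2002].
* P. Billingsley, *Convergence of Probability Measures*, 2nd ed. (1999), Thm. 2.1 (portmanteau)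
  [Billingsley1999].

## Mathlib / tree

Mathlib: `ProbabilityMeasure.tendsto_measure_of_null_frontier_of_tendsto'`,
`Measure.countable_meas_level_set_pos`, `frontier_lt_subset_eq`, `Cardinal.Real.Icc_countable_iff`,
`Filter.limsup_le_limsup`, `Filter.eventually_lt_of_limsup_lt`, `Filter.Tendsto.limsup_eq`.
Tree: `OneArmSubsequentialLimits.lean` (`crossingBounds_of_subseqLimits`),
`OneArmHittingPDE.lean` (`IsHittingPDEData.measure_bounds`), `OneArmHittingPDEProofs.lean`
(`koebeCovering_const`), `OneArmScalingLimit.lean` (`real_triOpenCrossing_eq`,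
`tendsto_log_div_log_of_rpow_bounds`), `TriAnnulusCrossing.lean` (`triAnnulusCrossing_mono`).
-/

noncomputable section

open MeasureTheory Filter Topology Metric Set TopologicalSpace
open Literature.Probability.LatticeModels Literature.Probability.Percolation
open scoped ENNReal NNReal

namespace Literature.Probability.Percolation

/-! ### The elementary core: (3.1) with one `u` from uniform bounds and radial convergence -/

/-- **LSW's Thm. 1.2 + (3.1) from uniform power bounds and radial convergence** (the elementary
core). Suppose (i) one constant `C > 0` gives, for every `r ∈ (0, 1/2)` and all large `R`,
`C⁻¹ r^{5/48} / 2 ≤ P[C(rR, R)] ≤ 2 C r^{5/48}` (the conclusion of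
`crossingBounds_of_subseqLimits`), and (ii) for every `r ∈ (0, 1/2)` the crossing probabilities
`P[C(r'R, R)]` converge as `R → ∞` for at least one radius `r' ∈ [r/2, r]`. Then
`LawlerSchrammWerner2002_annulusCrossing` holds, with `u(r) := limsup_{R → ∞} P[C(rR, R)]`:
`u` is non-decreasing in `r` (`C(r'R, R) ⊆ C(rR, R)` for `r' ≤ r`), satisfies
`C⁻¹ r^{5/48}/2 ≤ u(r) ≤ 2 C r^{5/48}` on `(0, 1/2)`, so "`log u(r) / log r → 5/48`" (LSW p. 9,
first line); the upper bound of (3.1) is `limsup_R P[C(rR, R)] = u(r) ≤ u(2r) < 2 u(2r)`, and the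
lower bound is `P[C(rR, R)] ≥ P[C(r'R, R)] → u(r') ≥ u(r/2) > u(r/2)/2`.
[cite: LawlerSchrammWernerEJP2002, Thm. 1.2 (p. 2), (3.1) (p. 8) and p. 9] -/
theorem LawlerSchrammWerner2002_annulusCrossing_of_crossingBounds_of_tendsto {C : ℝ} (hC : 0 < C)
    (hb : ∀ r : ℝ, 0 < r → r < 1 / 2 → ∃ s₀ : ℝ, ∀ R : ℝ, s₀ ≤ R →
      C⁻¹ * r ^ (5 / 48 : ℝ) / 2 ≤ (triSitePercolation half).real (triOpenCrossing (r * R) R) ∧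
        (triSitePercolation half).real (triOpenCrossing (r * R) R) ≤ 2 * (C * r ^ (5 / 48 : ℝ)))
    (hconv : ∀ r : ℝ, 0 < r → r < 1 / 2 → ∃ r' : ℝ, r / 2 ≤ r' ∧ r' ≤ r ∧ ∃ c : ℝ,
      Tendsto (fun R : ℝ => (triSitePercolation half).real (triOpenCrossing (r' * R) R))
        atTop (𝓝 c)) :
    LawlerSchrammWerner2002_annulusCrossing := by
  -- `p r R = P[C(rR, R)]`, `u r = limsup_R p r R`
  set p : ℝ → ℝ → ℝ := fun r R => (triSitePercolation half).real (triOpenCrossing (r * R) R)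
    with hp
  set u : ℝ → ℝ := fun r => limsup (p r) atTop with hu
  have hbdd : ∀ r, IsBoundedUnder (· ≤ ·) atTop (p r) := fun r =>
    isBoundedUnder_of ⟨1, fun _ => measureReal_le_one⟩
  have hcobdd : ∀ r, IsCoboundedUnder (· ≤ ·) atTop (p r) := fun r =>
    isCoboundedUnder_le_of_le atTop fun _ => measureReal_nonneg
  -- `p` and `u` are non-decreasing in the inner radius
  have hpmono : ∀ {r r' R : ℝ}, r' ≤ r → 0 ≤ R → p r' R ≤ p r R := fun h hR =>
    measureReal_mono (triAnnulusCrossing_mono (mul_le_mul_of_nonneg_right h hR) le_rfl)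
  have humono : ∀ {r r' : ℝ}, r' ≤ r → u r' ≤ u r := by
    intro r r' h
    refine limsup_le_limsup ?_ (hcobdd r') (hbdd r)
    filter_upwards [eventually_ge_atTop (0 : ℝ)] with R hR using hpmono h hR
  -- the power bounds pass to `u`
  have hubds : ∀ r, 0 < r → r < 1 / 2 →
      C⁻¹ / 2 * r ^ (5 / 48 : ℝ) ≤ u r ∧ u r ≤ 2 * C * r ^ (5 / 48 : ℝ) := by
    intro r hr0 hr2
    obtain ⟨s₀, hs₀⟩ := hb r hr0 hr2
    have hev : ∀ᶠ R in atTop, C⁻¹ * r ^ (5 / 48 : ℝ) / 2 ≤ p r R ∧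
        p r R ≤ 2 * (C * r ^ (5 / 48 : ℝ)) :=
      (eventually_ge_atTop s₀).mono fun R hR => hs₀ R hR
    constructor
    · calc C⁻¹ / 2 * r ^ (5 / 48 : ℝ) = C⁻¹ * r ^ (5 / 48 : ℝ) / 2 := by ring
        _ ≤ u r := le_limsup_of_frequently_le (hev.mono fun R h => h.1).frequently (hbdd r)
    · calc u r ≤ 2 * (C * r ^ (5 / 48 : ℝ)) := limsup_le_of_le (hcobdd r) (hev.mono fun R h => h.2)
        _ = 2 * C * r ^ (5 / 48 : ℝ) := by ring
  have hupos : ∀ r, 0 < r → r < 1 / 2 → 0 < u r := fun r hr0 hr2 =>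
    lt_of_lt_of_le (by positivity) (hubds r hr0 hr2).1
  refine ⟨u, ?_, fun r hr0 hr2 => ?_⟩
  · -- "By Theorem 1.2, `log u(r) / log r → 5/48`"
    exact tendsto_log_div_log_of_rpow_bounds (L := C⁻¹ / 2) (U := 2 * C) (δ := 1 / 2)
      (by positivity) (by positivity) (by norm_num) fun r hr0 hr2 => hubds r hr0 hr2
  · -- (3.1): upper bound `P[C(rR, R)] < 2 u(2r)` eventually
    have h2r : u r < 2 * u (2 * r) := by
      have h1 : u r ≤ u (2 * r) := humono (by linarith)
      have h2 : 0 < u (2 * r) := lt_of_lt_of_le (hupos r hr0 hr2) h1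
      linarith
    have hup : ∀ᶠ R in atTop, p r R < 2 * u (2 * r) := eventually_lt_of_limsup_lt h2r (hbdd r)
    -- (3.1): lower bound `u(r/2)/2 < P[C(r'R, R)] ≤ P[C(rR, R)]` eventually
    obtain ⟨r', hr'1, hr'2, c, hc⟩ := hconv r hr0 hr2
    have hur' : u r' = c := hc.limsup_eq
    have hc2 : u (r / 2) ≤ c := hur' ▸ humono hr'1
    have hpos2 : 0 < u (r / 2) := hupos (r / 2) (by linarith) (by linarith)
    have hlow : ∀ᶠ R in atTop, u (r / 2) / 2 < p r' R :=
      hc.eventually_const_lt (show u (r / 2) / 2 < c by linarith)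
    obtain ⟨s₀, hs₀⟩ := eventually_atTop.1 (hup.and (hlow.and (eventually_ge_atTop (0 : ℝ))))
    refine ⟨s₀, fun R hR => ?_⟩
    obtain ⟨hupR, hlowR, hR0⟩ := hs₀ R hR
    exact ⟨hlowR.le.trans (hpmono hr'2 hR0), hupR.le⟩

/-- A countable set of radii misses a point of every window `[r/2, r]`, `r > 0` (the window is
uncountable): convergence of `P[C(rR, R)]` for all radii in `(0, 1)` off a countable set gives
convergence at some radius of every window. [folklore] -/
theorem exists_mem_Icc_tendsto_real_triOpenCrossing {N : Set ℝ} (hN : N.Countable)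
    (hconv : ∀ r : ℝ, 0 < r → r < 1 → r ∉ N → ∃ c : ℝ,
      Tendsto (fun R : ℝ => (triSitePercolation half).real (triOpenCrossing (r * R) R))
        atTop (𝓝 c))
    {r : ℝ} (hr0 : 0 < r) (hr1 : r < 1) :
    ∃ r' : ℝ, r / 2 ≤ r' ∧ r' ≤ r ∧ ∃ c : ℝ,
      Tendsto (fun R : ℝ => (triSitePercolation half).real (triOpenCrossing (r' * R) R))
        atTop (𝓝 c) := by
  have hnc : ¬ (Icc (r / 2) r).Countable := by
    rw [Cardinal.Real.Icc_countable_iff, not_le]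
    linarith
  obtain ⟨r', hr', hr'N⟩ : ∃ r' ∈ Icc (r / 2) r, r' ∉ N := by
    by_contra hcon
    push Not at hcon
    exact hnc (hN.mono fun x hx => hcon x hx)
  exact ⟨r', hr'.1, hr'.2, hconv r' (by linarith [hr'.1]) (by linarith [hr'.2]) hr'N⟩

/-! ### The fact from LSW §2 at subsequential limits and radial convergence -/

/-- **LSW Theorem 1.2 with (3.1) from subsequential limits and radial convergence.** Assume the
subsequential hitting-PDE hypotheses of `oneArm_exponent_of_subseqHittingPDE` — one datum
`(h, h_θ, h_θθ, h_t)` with the properties of LSW Lemma 2.2, (2.3), Lemma 2.3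
(`H : IsHittingPDEData h h_θ h_θθ h_t`) such that (2.2) at `θ = 2π`,
`h(2π, t) = ν{K | 𝔯(K) ≤ e^{-t}}`, holds for every weak limit `ν` of the laws `lswLaw R` of
`Q_{1/R}` along a sequence `R_k → ∞` (`hid`) — and radial convergence: for all radii `r ∈ (0, 1)`
off a countable set `N`, the one-arm annulus probabilities `P[C(rR, R)]` converge as `R → ∞`
(for LSW "the definition of the scaling limit", p. 8; a consequence of the existence of the weak
limit of `lswLaw`, `tendsto_real_triOpenCrossing_of_scalingLimit`). Then
`LawlerSchrammWerner2002_annulusCrossing` holds: the constant of Thm. 1.2 is uniform over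
subsequential limits (`IsHittingPDEData.measure_bounds` with `koebeCovering_const`),
`crossingBounds_of_subseqLimits` gives the uniform power bounds, and
`LawlerSchrammWerner2002_annulusCrossing_of_crossingBounds_of_tendsto` concludes.
[cite: LawlerSchrammWernerEJP2002, Thm. 1.2 (p. 2), §2, §3 (3.1) (p. 8)] -/
theorem LawlerSchrammWerner2002_annulusCrossing_of_subseqHittingPDE {h hθ hθθ ht : ℝ → ℝ → ℝ}
    (H : IsHittingPDEData h hθ hθθ ht)
    (hid : ∀ (R : ℕ → ℝ) (ν : ProbabilityMeasure (NonemptyCompacts ℂ)),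
      Tendsto R atTop atTop → Tendsto (lswLaw ∘ R) atTop (𝓝 ν) →
        ∀ t, h (2 * Real.pi) t = (ν : Measure (NonemptyCompacts ℂ)).real
          {K | Literature.Analysis.Complex.conformalRadius (K : Set ℂ) ≤ Real.exp (-t)})
    {N : Set ℝ} (hN : N.Countable)
    (hconv : ∀ r : ℝ, 0 < r → r < 1 → r ∉ N → ∃ c : ℝ,
      Tendsto (fun R : ℝ => (triSitePercolation half).real (triOpenCrossing (r * R) R))
        atTop (𝓝 c)) :
    LawlerSchrammWerner2002_annulusCrossing := by
  obtain ⟨C, hC, hb⟩ := H.measure_bounds koebeCovering_const (by positivity)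
  have hlim : ∀ (R : ℕ → ℝ) (ν : ProbabilityMeasure (NonemptyCompacts ℂ)),
      Tendsto R atTop atTop → Tendsto (lswLaw ∘ R) atTop (𝓝 ν) →
        ∀ r : ℝ, 0 < r → r < 1 / 2 →
          C⁻¹ * r ^ (5 / 48 : ℝ) ≤ (ν : Measure (NonemptyCompacts ℂ)).real (meetsBall r) ∧
            (ν : Measure (NonemptyCompacts ℂ)).real (meetsClosedBall r) ≤ C * r ^ (5 / 48 : ℝ) :=
    fun R ν hR hν => hb ν (hid R ν hR hν)
  exact LawlerSchrammWerner2002_annulusCrossing_of_crossingBounds_of_tendsto hC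
    (fun r hr0 hr2 => crossingBounds_of_subseqLimits hC hlim hr0 hr2)
    (fun r hr0 hr2 => exists_mem_Icc_tendsto_real_triOpenCrossing hN hconv hr0 (by linarith))

/-- The same with radial convergence at every radius `r ∈ (0, 1)` (empty exceptional set).
[cite: LawlerSchrammWernerEJP2002, Thm. 1.2 (p. 2), §3 (3.1) (p. 8)] -/
theorem LawlerSchrammWerner2002_annulusCrossing_of_subseqHittingPDE' {h hθ hθθ ht : ℝ → ℝ → ℝ}
    (H : IsHittingPDEData h hθ hθθ ht)
    (hid : ∀ (R : ℕ → ℝ) (ν : ProbabilityMeasure (NonemptyCompacts ℂ)),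
      Tendsto R atTop atTop → Tendsto (lswLaw ∘ R) atTop (𝓝 ν) →
        ∀ t, h (2 * Real.pi) t = (ν : Measure (NonemptyCompacts ℂ)).real
          {K | Literature.Analysis.Complex.conformalRadius (K : Set ℂ) ≤ Real.exp (-t)})
    (hconv : ∀ r : ℝ, 0 < r → r < 1 → ∃ c : ℝ,
      Tendsto (fun R : ℝ => (triSitePercolation half).real (triOpenCrossing (r * R) R))
        atTop (𝓝 c)) :
    LawlerSchrammWerner2002_annulusCrossing :=
  LawlerSchrammWerner2002_annulusCrossing_of_subseqHittingPDE H hid countable_empty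
    fun r hr0 hr1 _ => hconv r hr0 hr1

/-! ### Radial convergence from the weak limit on the Hausdorff space -/

/-- **The scaling limit gives radial convergence** (LSW p. 8, "By the definition of the scaling
limit"): if the laws `lswLaw R` of `Q_{1/R}` converge weakly to `ν`, then for every radius
`r ∈ (0, 1)` that is not an atom of `dist(0, K)` under `ν` — all but countably many — the event
`{dist(0, K) < r} = meetsBall r` is a `ν`-continuity set (its frontier lies in
`{dist(0, K) = r}`), so `P[C(rR, R)] = P[Q_{1/R} ∈ meetsBall r] → ν(meetsBall r)` by the
portmanteau theorem. [cite: Billingsley1999, Thm 2.1]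
[cite: LawlerSchrammWernerEJP2002, §3 (p. 8)] -/
theorem tendsto_real_triOpenCrossing_of_scalingLimit
    (hsl : ∃ ν : ProbabilityMeasure (NonemptyCompacts ℂ), Tendsto lswLaw atTop (𝓝 ν)) :
    ∃ N : Set ℝ, N.Countable ∧ ∀ r : ℝ, 0 < r → r < 1 → r ∉ N → ∃ c : ℝ,
      Tendsto (fun R : ℝ => (triSitePercolation half).real (triOpenCrossing (r * R) R))
        atTop (𝓝 c) := by
  obtain ⟨ν, hν⟩ := hsl
  refine ⟨{r | 0 < (ν : Measure (NonemptyCompacts ℂ))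
      {K : NonemptyCompacts ℂ | infDist (0 : ℂ) (K : Set ℂ) = r}},
    Measure.countable_meas_level_set_pos continuous_infDist_zero_nonemptyCompacts.measurable,
    fun r _ hr1 hrN => ?_⟩
  have hsub : frontier (meetsBall r) ⊆
      {K : NonemptyCompacts ℂ | infDist (0 : ℂ) (K : Set ℂ) = r} :=
    frontier_lt_subset_eq (f := fun K : NonemptyCompacts ℂ => infDist (0 : ℂ) (K : Set ℂ))
      (g := fun _ => r) continuous_infDist_zero_nonemptyCompacts continuous_const
  have hnull : (ν : Measure (NonemptyCompacts ℂ)) (frontier (meetsBall r)) = 0 :=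
    measure_mono_null hsub (nonpos_iff_eq_zero.1 (not_lt.1 hrN))
  have ht := ProbabilityMeasure.tendsto_measure_of_null_frontier_of_tendsto' hν hnull
  refine ⟨((ν : Measure (NonemptyCompacts ℂ)) (meetsBall r)).toReal, ?_⟩
  refine ((ENNReal.tendsto_toReal (measure_ne_top _ _)).comp ht).congr' ?_
  filter_upwards [eventually_gt_atTop (0 : ℝ)] with R hR
  rw [Function.comp_apply, real_triOpenCrossing_eq hr1.le hR]

/-- **The fact from the weak limit and LSW §2 at subsequential limits**: the existence of the
scaling limit (hypothesis `hsl`) supplies radial convergence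
(`tendsto_real_triOpenCrossing_of_scalingLimit`), so together with the subsequential
hitting-PDE hypotheses it gives `LawlerSchrammWerner2002_annulusCrossing`. With
`LawlerSchrammWerner2002_subseqHittingPDE_of_scalingLimit` (the hypotheses from
`scalingLimit ∧ hittingPDE`) this is the printed route of LSW §3, as in
`LawlerSchrammWerner2002_annulusCrossing_of_scalingLimit`.
[cite: LawlerSchrammWernerEJP2002, Thm. 1.2 (p. 2), §3 (3.1) (p. 8)] -/
theorem LawlerSchrammWerner2002_annulusCrossing_of_scalingLimit_of_subseqHittingPDE
    (hsl : ∃ ν : ProbabilityMeasure (NonemptyCompacts ℂ), Tendsto lswLaw atTop (𝓝 ν))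
    {h hθ hθθ ht : ℝ → ℝ → ℝ}
    (H : IsHittingPDEData h hθ hθθ ht)
    (hid : ∀ (R : ℕ → ℝ) (ν : ProbabilityMeasure (NonemptyCompacts ℂ)),
      Tendsto R atTop atTop → Tendsto (lswLaw ∘ R) atTop (𝓝 ν) →
        ∀ t, h (2 * Real.pi) t = (ν : Measure (NonemptyCompacts ℂ)).real
          {K | Literature.Analysis.Complex.conformalRadius (K : Set ℂ) ≤ Real.exp (-t)}) :
    LawlerSchrammWerner2002_annulusCrossing := by
  obtain ⟨N, hN, hconv⟩ := tendsto_real_triOpenCrossing_of_scalingLimit hsl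
  exact LawlerSchrammWerner2002_annulusCrossing_of_subseqHittingPDE H hid hN hconv

/-- **The printed route, recovered**: `scalingLimit ∧ hittingPDE ⇒ annulusCrossing` through the
subsequential hypotheses (`LawlerSchrammWerner2002_subseqHittingPDE_of_scalingLimit`) — a check
that the hypotheses of `LawlerSchrammWerner2002_annulusCrossing_of_subseqHittingPDE` are implied
by LSW's two printed continuum inputs. [cite: LawlerSchrammWernerEJP2002, §2–§3] -/
theorem LawlerSchrammWerner2002_annulusCrossing_of_scalingLimit_of_hittingPDE
    (h₁ : ∃ ν : ProbabilityMeasure (NonemptyCompacts ℂ), Tendsto lswLaw atTop (𝓝 ν))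
    (h₂ : LawlerSchrammWerner2002_hittingPDE) :
    LawlerSchrammWerner2002_annulusCrossing := by
  obtain ⟨h, hθ, hθθ, ht, H, hid⟩ := LawlerSchrammWerner2002_subseqHittingPDE_of_scalingLimit h₁ h₂
  exact LawlerSchrammWerner2002_annulusCrossing_of_scalingLimit_of_subseqHittingPDE h₁ H hid

end Literature.Probability.Percolation
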